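import Mathlib
import HarnessLib
import HarnessLib.Audit
import Summits.ValiantsHypothesis.Statement
import Literature.Barriers.ValiantsHypothesis.MonotoneGap
import Summits.ValiantsHypothesis.ValiantsHypothesis.Theorems.SymPencilHubPerNotVp

/-!
Route: FreeEnergyLift

# Route FreeEnergyLift — the permanent's free energy log per(e^U) has no small exp+SDP lift, while
nonnegative VP free energies do

X = H1 ∧ H2 (card free-energy-convex-lift). For a polynomial f with nonnegative coefficients its
FREE ENERGY
φ_f(u) := log f(e^u) is convex; measure f by the least size k + m of an exact conic lift of the
epigraph
{(u,t) : φ_f(u) ≤ t} by k exponential cones and one psd cone S^m_+ (Gouveia–Parrilo–Thomas lifts;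
the
conic-inequality form {x | ∃ y, A(x,y) + b ∈ K_exp^k × S^m_+} is inlined in every item). H1
(TRANSFER): every
VP_ℂ family with nonnegative real coefficients has free-energy lifts of quasi-polynomial size. H2
(LOWER BOUND):
the free energy of the permanent, log per_n(e^U) — the log-partition function of the permanental
Gibbs family —
has no quasi-polynomial exp+psd lift. H1 ∧ H2 ⇒ per ∉ VP_ℂ ⇒ VP_ℂ ≠ VNP_ℂ.
Lean: `FreeEnergyLiftTransfer ∧ PermanentFreeEnergyNoQPLift`

## Assembly
Provable now (checked sorry-free in the planner's AssemblyCheck.lean, 12 lines): assume H1, H2; by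
the hub theorem
`Summit.ValiantsHypothesis.Hub.valiantsHypothesis_of_not_isVPFamily_per` with the proved cone facts
`mem_VP_ofFintype_iff_holds` and `perFamily_mem_VNP_holds` it suffices to refute IsVPFamily (per_n
over ℂ). If per ∈ VP_ℂ,
`map_perPoly` rewrites per_ℂ = map (ℝ≥0 → ℂ) per_{ℝ≥0}, H1 gives c and for every n a lift of size ≤
2^{(log₂ n + c)^c} of the
free-energy epigraph of map (ℝ≥0 → ℝ) per_{ℝ≥0} = per_ℝ (`map_perPoly` again); H2 at this c gives n
where every such lift is
larger — `omega`.

Rationale: WHY THIS LINE. A monotone circuit of size s is, gate by gate, a geometric program: in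
log-coordinates a ×-gate adds and a +-gate is
one log-sum-exp, so epi(log f(e^u)) has an exact lift with O(s) exponential cones (item
MonotoneToLift) — the
FUNCTION-level refinement of Hrubeš–Yehudayoff's support-level fact xc(Newt f) = O(monotone size)
(doi:10.4230/LIPIcs.CCC.2021.9). Unlike the Newton polytope (Newt(per_n) = Birkhoff, xc ≤ n², blind
to per), the free
energy sees COEFFICIENTS, so the permanent itself becomes the target, and lift size is measured
against exp AND psd
cones, where cancellations can in principle be re-encoded (ST = det, Pfaffians) — this is how the
line proposes to
step around the monotone gap (Valiant1980, JerrumSnir1982, arXiv:2109.06941) instead of through it.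
Imported area:
convex algebraic geometry of lifts — Yannakakis–GPT factorisation (arXiv:1111.3164 Def 2.1 and Thm
2.4; non-compact
sets arXiv:1501.00115): lift size = cone rank of the slack operator, which for these epigraphs is
the Bregman/KL kernel
(u,u') ↦ KL(Gibbs_{u'} ‖ Gibbs_u); psd-rank lower-bound technology (arXiv:1411.6317,
arXiv:1705.06996, arXiv:1902.06401);
and the reverse bridge already in print, hardness ⇒ no small spectrahedral representation
(arXiv:1711.11497,
doi:10.1145/3373207.3404010). No existing route of the sub (GCTMult, IntegralGCT, DetQP, Depth4,
Elusive, TauConst,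
BoolTransfer) uses positivity or convexity; the negatives index is empty.

RANKED CRUXES. #2 SpanningTreeFreeEnergyLift (crux) — FIRST TEST OF H1 (most informative item): the
Jerrum–Snir spanning-tree (arborescence) family `stPoly ℝ N` — in VP, monotone complexity 2^{Ω(N)} —
has exp+psd lifts of its free-energy epigraph {(u,t) : log ST_N(e^u) ≤ t} of quasi-polynomial size
2^{(log₂ N + c)^c}. Equivalently: the log-partition function of the weighted
uniform-spanning-arborescence measure (log det of the reduced directed Laplacian at weights e^u) has
a small exact convex program. A proof keeps H1 alive and expands the branch; a refutation kills H1
through TransferGivesSpanningTreeLift + the cone fact isVPFamily_stPoly and turns the card into a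
barrier entry "convex-lift gap". [difficulty: L] (why it might fail: ST needs 2^{Ω(N)} monotone
gates (JS82 §4.5, CDGM22) and every exact description of log det(Σ e^{u_e}B_e) from ABOVE found so
far has terms a_e·e^{u_e} with a = bᵀSb linear in S ⪰ 0 — not jointly convex; max-entropy/capacity
of real-stable p is only solved by oracle methods.) [JerrumSnir1982, arXiv:2109.06941,
arXiv:1611.04548, arXiv:1511.03730, arXiv:1304.8108]
#3 FreeEnergyLiftTransfer (crux) — H1 (card K1): for every p-family (f_n) with coefficients in ℝ≥0
whose complexification is in VP_ℂ there is c with: for all n the epigraph {(u,t) : log f_n(e^u) ≤ t}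
has an exact lift by k exponential cones and one psd cone of order m with k + m ≤ 2^{(log₂ n +
c)^c}. [deps: SpanningTreeFreeEnergyLift] [difficulty: open-problem] (why it might fail: Even its
support shadow (xc(Newt f) quasi-poly for f ∈ VP) is open (HY21); cancellation f = Q − R acts as
log(e^{φ_Q} − e^{φ_R}), a DIFFERENCE of convex programs with no lift calculus; one nonneg VP family
with a lift lower bound (ST, planar matchings, Schur) kills it.) [doi:10.4230/LIPIcs.CCC.2021.9,
Valiant1980, JerrumSnir1982, arXiv:2109.06941, arXiv:1111.3164]
#4 PermanentFreeEnergyNoQPLift (crux) — H2 (card K2): for every c there is n such that every exact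
exp+psd lift of {(U,t) : log per_n(e^U) ≤ t} has size k + m > 2^{(log₂ n + c)^c}; equivalently (GPT
factorisation) the KL kernel of the permanental Gibbs measures U ↦ P_U(σ) ∝ exp⟨U, P_σ⟩ has
super-quasi-polynomial (K_exp^k × S^m_+)-factorisation rank. The expected truth is 2^{n^{Ω(1)}}; the
qp form is what the assembly consumes. [difficulty: open-problem] (why it might fail: No lower-bound
method for exp-cone rank exists; psd-rank bounds (LRS) run through SOS degree of a slack MATRIX,
here a KL kernel degenerating to Birkhoff-face data on supports; a non-uniform exact lift with
transcendental data contradicts no theorem (Bethe/Sinkhorn GPs are within additive O(n)).)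
[arXiv:1111.3164, arXiv:1501.00115, arXiv:1411.6317, arXiv:1705.06996, arXiv:1107.4196,
arXiv:1811.02933, arXiv:1304.8108]
#5 PermanentExpConeLowerBound (crux) — first rung of H2 (exp cones only, no psd block = exact
GEOMETRIC PROGRAMS): for every c there is n such that no lift of {(U,t) : log per_n(e^U) ≤ t} by k ≤
2^{(log₂ n + c)^c} exponential cones (linear inequalities ride on the cone's faces) is exact.
Implied by H2 (take m = 0); the place where a lower-bound technique for free-energy lifts must first
be invented (log-Laplace structure of GP value functions, Khovanskii-type counting, entropy-program
duality arXiv:1409.7640). [difficulty: XL] (why it might fail: Sinkhorn capacity log cap(e^U) is an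
exact O(n²)-cone GP within additive n of log per (van der Waerden/LSW), Bethe likewise; GP value
functions are log-Laplace transforms of iterated convolutions but no invariant separating them from
per's is known (fewnomial counting gives only k ≳ √(n log n)).) [arXiv:1107.4196, arXiv:1811.02933,
arXiv:1409.7640, doi:10.1007/s004930070007, arXiv:1111.3164]
#9 MonotoneToLift (support) — the dictionary (geometric programming, folklore): a Jerrum–Snir
monotone computation P of f over ℝ≥0 (fan-in two, plain gates) yields an exact lift of {(u,t) : log
f(e^u) ≤ t} by at most 8·size(P) + 8 exponential cones and no psd block (×-gate: add the
log-variables; +-gate: t_v ≥ log(e^{t_a} + e^{t_b}) = two exp cones + one face inequality; gates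
computing 0 are pruned first). [difficulty: provable-now] [doi:10.4230/LIPIcs.CCC.2021.9,
arXiv:1409.7640, JerrumSnir1982]
#9 TransferGivesSpanningTreeLift (support) — glue of the kill chain: H1 together with the cone fact
`ST ∈ VP over every field` gives the spanning-tree lift (instantiate H1 at σ N = Fin N × Option (Fin
N), f N = stPoly ℝ≥0 N; `map_stPoly` moves between ℝ≥0, ℝ, ℂ). Hence ¬SpanningTreeFreeEnergyLift ∧
isVPFamily_stPoly refutes H1. [difficulty: provable-now] [JerrumSnir1982, arXiv:2109.06941]
#9 Hub (support) — the shared permanent hub (stmt-ValiantsHypothesis-0317, proved in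
Theorems/HubHub.lean): per ∉ VP (as IsVPFamily), the renaming bridge and per ∈ VNP give VP_ℂ ≠
VNP_ℂ. [difficulty: provable-now] [Valiant1979, Burgisser2000]

TWO-LAYER PLAN. H2 ⇐ SlackFactorisation → KLKernelRank → H2: (i) the Yannakakis–GPT theorem for
these non-compact epigraphs (arXiv:1111.3164
Thm 2.4, arXiv:1501.00115): an exact proper (K_exp^k × S^m_+)-lift factorises the Bregman/KL slack
kernel
D(u,u') = log f(e^u) − log f(e^{u'}) − ⟨∇, u − u'⟩ through the cone and its dual; (ii) a rank lower
bound for the permanental KL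
kernel. H1 ⇐ (PSD-pencil free energies log det(Σ_e e^{u_e} B_e), B_e ⪰ 0, lift in poly(order, #e)) →
(planar perfect
matchings |Pf|, Schur s_λ) → (closure of qp-liftability under the VP normal form) — filed only after
SpanningTreeFreeEnergyLift
closes. PermanentExpConeLowerBound ⇐ (GP value functions restricted to lines are log-Laplace
transforms of k-fold
sup-convolution measures) → (per's line restrictions are not) — glue later.

KILL CRITERIA. ¬SpanningTreeFreeEnergyLift proved (with the cone fact isVPFamily_stPoly, via
TransferGivesSpanningTreeLift) refutes H1: close
`refuted:FreeEnergyLiftTransfer` and hand the theorem to the barrier catalogue as "ConvexLiftGap"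
(lift rank does not transfer
either); there is no pivot, since psd blocks and quasi-polynomial size are already allowed.
¬PermanentExpConeLowerBound (an
exact quasi-polynomial geometric program for log per_n(e^U)) refutes H2 and closes the route
outright (and would be a striking
algorithmic fact). A proof elsewhere of per ∉ VP moots the route; a proof that xc(Newt f) can be
2^{n^{Ω(1)}} for some
nonnegative f ∈ VP does NOT kill H1 formally but forces a re-examination (recession cone of a lift).

NOT DECOMPOSED YET. The slack/KL factorisation theorem for non-compact, non-semialgebraic epigraphs
(properness, closure conventions of K_exp^*)
— a layer-2 child of H2, typed only when H2 is staffed; the PSD-pencil generalisation of the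
spanning-tree test (undirected
Kirchhoff polynomial, needs "Kirchhoff ∈ VP" as a fact); planar-matching and Schur instances of H1;
any quantitative
exponent in H2 (2^{n^ε}); bit-size/uniformity refinements linking small lifts to deterministic
permanent approximation
(deliberately NOT used: H2 is unconditional and non-uniform).

CHEAPEST FALSIFIER. Literature/structural check on the rank-2 item: is u ↦ log det(Σ_e e^{u_e} b_e
b_eᵀ) (equivalently max-entropy over spanning
trees with given marginals, or rank-one Brascamp–Lieb capacity in log-coordinates) known to be
exp+SDP-representable with
poly many cones? Searched (zbMATH: "maximum entropy spanning tree distribution marginals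
determinantal" 0 hits; "real stable
polynomials matroids optimization counting" → arXiv:1611.04548, oracle/ellipsoid methods only;
"operator scaling
Brascamp-Lieb" → arXiv:1607.06711, arXiv:1511.03730, geodesic methods only): no compact formulation
found either way. The
refuter's first computation: for N = 3,4 fit the boundary of epi(log ST_N(e^u)) restricted to random
2-planes against
k-exp-cone GP value functions with k ≤ 6 (kit, nonconvex fit) — a clean impossibility pattern there
would guide
¬SpanningTreeFreeEnergyLift. I could not run it (planner; kit not in this unit).

NUMBERS. Monotone ⊗-complexity of per_n = n(2^{n−1} − 1) exactly (JerrumSnir1982 §4.3) ⇒ GP lift of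
log per with ≤ 8n2^{n−1} cones
(MonotoneToLift); trivial lift: n! + 1 cones. ST_{N+1}: monotone ≥ 2^{cN} (JS82 §4.5; 2^{Ω(n)} for
expanders, arXiv:2109.06941)
vs an (N×N) determinant. xc(Newt per_n) = xc(Birkhoff B_n) ≤ n². Surrogates: Sinkhorn capacity
(O(n²) exp cones) and the Bethe
free energy (O(n²) cones) approximate log per_n within additive O(n) (van der Waerden e^{−n}; per_B
≤ per ≤ 2^{O(n)} per_B:
arXiv:1107.4196, arXiv:1811.02933, doi:10.1007/s004930070007). psd-rank lower bounds in print: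
2^{Ω(n^{δ})} for cut/TSP/
matching polytopes (arXiv:1411.6317), ≥ c·√(log d) for generic bodies of algebraic degree d
(arXiv:1705.06996). Items at open: 8.

DEFINITION REQUESTS. After open: `HasExpPsdLift` (Gouveia–Parrilo–Thomas K-lift of a convex set for
K = K_exp^k × S^m_+, arXiv:1111.3164 Def 2.1,
in the conic-inequality form used inline here) and `freeEnergy f u := Real.log (MvPolynomial.eval
(Real.exp ∘ u) f)`, topic
Literature/Analysis/Convex, so that the items can later be restated over named notions (statements
unchanged). Cite fact
wanted later (layer 2): GPT13 Thm 2.4 / Wang–Zhi for closed convex sets.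

Novelty: Searches (2026-08-15): `lit search --source zbmath` × 14 ("lifts of convex sets cone factorizations"
→ arXiv:1111.3164,
arXiv:2002.09788, arXiv:1501.00115; "shadows of Newton polytopes monotone arithmetic circuits" →
doi:10.4230/lipics.ccc.2021.9;
"entropy optimization and counting" → arXiv:1304.8108; "hyperbolicity cones spectrahedral
representation lower bounds" →
arXiv:1711.11497, doi:10.1145/3373207.3404010; "Bethe permanent approximation" → arXiv:1107.4196,
arXiv:1811.02933,
arXiv:2205.15186; "expressive power of convex cones chains of faces" → arXiv:1902.06401; "lower
bound positive semidefinite rank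
convex bodies" → arXiv:1705.06996; "relative entropy relaxations signomial" → arXiv:1409.7640,
arXiv:1907.00814; "operator scaling
Brascamp-Lieb" → arXiv:1607.06711, arXiv:1511.03730; "real stable polynomials matroids" →
arXiv:1611.04548; "exponential cone
representable sets geometric programming lift", "semidefinite representation log-determinant
exponential coordinates",
"maximum entropy spanning tree … determinantal" → 0 hits each); `lit vsearch` (held corpus, 8 docs,
none relevant);
`lit frontier ValiantsHypothesis --since 2020` (30 rows; nothing on convex lifts; arXiv:2605.09551
min-plus VP/VNP is tropical,
tangential); `lit bridges ValiantsHypothesis --cross any`; `lit read arxiv:1111.3164` p.5 (Def 2.1,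
Thm 2.4 verbatim);
`lit galaxy search … --star all` saturated (queued > 90 s, twice) and openalex/arxiv/s2 legs
rate-limited (429) — recorded;
HY21 full text wanted (  [refs: 10.4230/lipics.ccc.2021.9, 10.1145/3373207.3404010, 1111.3164, 2002.09788, 1501.00115, 1304.8108, 1711.11497, 1107.4196, 1811.02933, 2205.15186, 1902.06401, 1705.06996, 1409.7640, 1907.00814, 1607.06711, 1511.03730, 1611.04548, 2605.09551, doi:10.4230/lipics.ccc.2021.9, doi:10.1145/3373207.3404010, arxiv:1111.3164]

Barriers (technique_class: convex-lift-rank, free-energy, monotone-transfer): - technique_class: convex-lift-rank, free-energy, monotone-transfer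
- Literature.Barriers.ValiantsHypothesis.MonotoneGap: engaged head-on, not evaded by fiat: the
transferred invariant is exp+psd LIFT SIZE of the free energy, not monotone circuit size; the
barrier's witnesses (ST, planar matchings; Schur) are exactly where lift size and monotone size must
part, and the ST instance is filed as the rank-2 crux with the formal kill chain
TransferGivesSpanningTreeLift; the ε-sensitive refinement (CDGM22, SensitiveTransfer) concerns
monotone SIZE of F ∓ εST and is not invoked.
- Literature.Barriers.ValiantsHypothesis.AlgebraicNaturalProofs: "epi(log f(e^u)) has no lift of
size s" is an ∃∀-statement over real lift data, not the vanishing of a VP-constructible polynomial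
in the coefficients of f, so H2 is not a distinguisher in the FSV format; honest caveat: if H2 were
eventually proved through a finite-dimensional rank condition on finitely many KL values it could
re-enter the (conditional) barrier's scope — the bet is that convex duality, not an algebraic test,
carries the proof.
- Literature.Barriers.ValiantsHypothesis.RankMethods: the measure is a CONE rank of an infinite
kernel (psd/exp factorisation rank), not the rank of a linear image L(f) of the coefficient vector,
and it is not sub-additive in f; EGOW's upper bounds on rank-method separations do not apply
formally — caveat: LRS-type psd-rank bounds pass through SOS degree, whose free-energy analogue is
unknown.
- Literatur

sub-problem: ValiantsHypothesis · status: done · opened planner-plancard-ValiantsHypothesis-ValiantsH-6fe7c762-0 2026-08-15T11:41:48Z · rev 0 · ledger route-ValiantsHypothesis-FreeEnergyLift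
GENERATED by the gate from the ledger (D-0016/17). Provers cite these decls: `theorem foo : Summit.ValiantsHypothesis.ValiantsHypothesis.Theses.FreeEnergyLift.<Decl> := …` in Summits/ValiantsHypothesis/ValiantsHypothesis/Theorems/<Name>.lean.
-/

namespace Summit.ValiantsHypothesis.ValiantsHypothesis.Theses.FreeEnergyLift

open scoped BigOperators Topology Manifold Classical MeasureTheory ProbabilityTheory Matrix InnerProductSpace ComplexConjugate ContinuousMap
open Filter Set Function TopologicalSpace MeasureTheory

attribute [summit_statement] _root_.ValiantsHypothesis

open Literature.PNP

/-- item stmt-ValiantsHypothesis-5602 · crux · rank 2 · open · by planner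
why it might fail: ST needs 2^{Ω(N)} monotone gates (JS82 §4.5, CDGM22) and every exact description of log det(Σ e^{u_e}B_e) from ABOVE found so far has terms a_e·e^{u_e} with a = bᵀSb linear in S ⪰ 0 — not jointly convex; max-entropy/capacity of real-stable p is only solved by oracle methods.
sources: JerrumSnir1982, arXiv:2109.06941, arXiv:1611.04548, arXiv:1511.03730, arXiv:1304.8108
[crux] FIRST TEST OF H1 (most informative item): the Jerrum–Snir spanning-tree (arborescence) family
`stPoly ℝ N` — in VP, monotone complexity 2^{Ω(N)} — has exp+psd lifts of its free-energy epigraph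
{(u,t) : log ST_N(e^u) ≤ t} of quasi-polynomial size 2^{(log₂ N + c)^c}. Equivalently: the
log-partition function of the weighted uniform-spanning-arborescence measure (log det of the reduced
directed Laplacian at weights e^u) has a small exact convex program. A proof keeps H1 alive and
expands the branch; a refutation kills H1 through TransferGivesSpanningTreeLift + the cone fact
isVPFamily_stPoly and turns the card into a barrier entry "convex-lift gap". [difficulty: L] -/
@[route_item "route-ValiantsHypothesis-FreeEnergyLift"]
def SpanningTreeFreeEnergyLift : Prop :=
  ∃ c : ℕ, ∀ N : ℕ, ∃ (k m p : ℕ) (A : ((Fin N × Option (Fin N) → ℝ) × ℝ) × (Fin p → ℝ) →ₗ[ℝ] (Fin k → ℝ × ℝ × ℝ) × Matrix (Fin m) (Fin m) ℝ) (b : (Fin k → ℝ × ℝ × ℝ) × Matrix (Fin m) (Fin m) ℝ), k + m ≤ 2 ^ ((Nat.log 2 N + c) ^ c) ∧ ∀ (u : Fin N × Option (Fin N) → ℝ) (t : ℝ), (Real.log (MvPolynomial.eval (fun i => Real.exp (u i)) (Literature.Barriers.ValiantsHypothesis.stPoly ℝ N)) ≤ t ↔ ∃ y : Fin p → ℝ,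 (∀ i, (A ((u, t), y) + b).1 i ∈ {w : ℝ × ℝ × ℝ | (0 < w.2.1 ∧ w.2.1 * Real.exp (w.1 / w.2.1) ≤ w.2.2) ∨ (w.2.1 = 0 ∧ w.1 ≤ 0 ∧ 0 ≤ w.2.2)}) ∧ (A ((u, t), y) + b).2.PosSemidef)

/-- item stmt-ValiantsHypothesis-5603 · crux · rank 3 · open · by planner
why it might fail: Even its support shadow (xc(Newt f) quasi-poly for f ∈ VP) is open (HY21); cancellation f = Q − R acts as log(e^{φ_Q} − e^{φ_R}), a DIFFERENCE of convex programs with no lift calculus; one nonneg VP family with a lift lower bound (ST, planar matchings, Schur) kills it.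
sources: doi:10.4230/LIPIcs.CCC.2021.9, Valiant1980, JerrumSnir1982, arXiv:2109.06941, arXiv:1111.3164
[crux] H1 (card K1): for every p-family (f_n) with coefficients in ℝ≥0 whose complexification is in
VP_ℂ there is c with: for all n the epigraph {(u,t) : log f_n(e^u) ≤ t} has an exact lift by k
exponential cones and one psd cone of order m with k + m ≤ 2^{(log₂ n + c)^c}. [deps:
SpanningTreeFreeEnergyLift] [difficulty: open-problem] -/
@[route_item "route-ValiantsHypothesis-FreeEnergyLift"]
def FreeEnergyLiftTransfer : Prop :=
  ∀ (σ : ℕ → Type) [∀ n, Fintype (σ n)] (f : ∀ n, MvPolynomial (σ n) NNReal), Literature.Computability.AlgebraicComplexity.IsVPFamily (k := ℂ) (fun n => MvPolynomial.map ((algebraMap ℝ ℂ).comp NNReal.toRealHom) (f n)) → ∃ c : ℕ, ∀ n : ℕ, ∃ (k m p : ℕ) (A : ((σ n → ℝ) × ℝ) × (Fin p → ℝ) →ₗ[ℝ] (Fin k → ℝ × ℝ × ℝ) × Matrix (Fin m) (Fin m) ℝ) (b : (Fin k → ℝ × ℝ × ℝ) × Matrix (Fin m) (Fin m) ℝ),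 k + m ≤ 2 ^ ((Nat.log 2 n + c) ^ c) ∧ ∀ (u : σ n → ℝ) (t : ℝ), (Real.log (MvPolynomial.eval (fun i => Real.exp (u i)) (MvPolynomial.map NNReal.toRealHom (f n))) ≤ t ↔ ∃ y : Fin p → ℝ, (∀ i, (A ((u, t), y) + b).1 i ∈ {w : ℝ × ℝ × ℝ | (0 < w.2.1 ∧ w.2.1 * Real.exp (w.1 / w.2.1) ≤ w.2.2) ∨ (w.2.1 = 0 ∧ w.1 ≤ 0 ∧ 0 ≤ w.2.2)}) ∧ (A ((u, t), y) + b).2.PosSemidef)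

/-- item stmt-ValiantsHypothesis-5604 · crux · rank 4 · open · by planner
why it might fail: No lower-bound method for exp-cone rank exists; psd-rank bounds (LRS) run through SOS degree of a slack MATRIX, here a KL kernel degenerating to Birkhoff-face data on supports; a non-uniform exact lift with transcendental data contradicts no theorem (Bethe/Sinkhorn GPs are within additive O(n)).
sources: arXiv:1111.3164, arXiv:1501.00115, arXiv:1411.6317, arXiv:1705.06996, arXiv:1107.4196, arXiv:1811.02933
[crux] H2 (card K2): for every c there is n such that every exact exp+psd lift of {(U,t) : log
per_n(e^U) ≤ t} has size k + m > 2^{(log₂ n + c)^c}; equivalently (GPT factorisation) the KL kernel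
of the permanental Gibbs measures U ↦ P_U(σ) ∝ exp⟨U, P_σ⟩ has super-quasi-polynomial (K_exp^k ×
S^m_+)-factorisation rank. The expected truth is 2^{n^{Ω(1)}}; the qp form is what the assembly
consumes. [difficulty: open-problem] -/
@[route_item "route-ValiantsHypothesis-FreeEnergyLift"]
def PermanentFreeEnergyNoQPLift : Prop :=
  ∀ c : ℕ, ∃ n : ℕ, ∀ (k m p : ℕ) (A : ((Fin n × Fin n → ℝ) × ℝ) × (Fin p → ℝ) →ₗ[ℝ] (Fin k → ℝ × ℝ × ℝ) × Matrix (Fin m) (Fin m) ℝ) (b : (Fin k → ℝ × ℝ × ℝ) × Matrix (Fin m) (Fin m) ℝ), (∀ (u : Fin n × Fin n → ℝ) (t : ℝ), (Real.log (MvPolynomial.eval (fun ij => Real.exp (u ij)) (Literature.Computability.AlgebraicComplexity.perPoly (Fin n) ℝ)) ≤ t ↔ ∃ y : Fin p → ℝ, (∀ i, (A ((u, t), y) + b).1 i ∈ {w : ℝ × ℝ × ℝ | (0 < w.2.1 ∧ w.2.1 * Real.exp (w.1 / w.2.1) ≤ w.2.2) ∨ (w.2.1 = 0 ∧ w.1 ≤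 0 ∧ 0 ≤ w.2.2)}) ∧ (A ((u, t), y) + b).2.PosSemidef)) → 2 ^ ((Nat.log 2 n + c) ^ c) < k + m

/-- item stmt-ValiantsHypothesis-5605 · crux · rank 5 · open · by planner
why it might fail: Sinkhorn capacity log cap(e^U) is an exact O(n²)-cone GP within additive n of log per (van der Waerden/LSW), Bethe likewise; GP value functions are log-Laplace transforms of iterated convolutions but no invariant separating them from per's is known (fewnomial counting gives only k ≳ √(n log n)).
sources: arXiv:1107.4196, arXiv:1811.02933, arXiv:1409.7640, doi:10.1007/s004930070007, arXiv:1111.3164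
[crux] first rung of H2 (exp cones only, no psd block = exact GEOMETRIC PROGRAMS): for every c there
is n such that no lift of {(U,t) : log per_n(e^U) ≤ t} by k ≤ 2^{(log₂ n + c)^c} exponential cones
(linear inequalities ride on the cone's faces) is exact. Implied by H2 (take m = 0); the place where
a lower-bound technique for free-energy lifts must first be invented (log-Laplace structure of GP
value functions, Khovanskii-type counting, entropy-program duality arXiv:1409.7640). [difficulty:
XL] -/
@[route_item "route-ValiantsHypothesis-FreeEnergyLift"]
def PermanentExpConeLowerBound : Prop :=
  ∀ c : ℕ, ∃ n : ℕ, ∀ (k p : ℕ) (A : ((Fin n × Fin n → ℝ) × ℝ) × (Fin p → ℝ) →ₗ[ℝ] (Fin k → ℝ × ℝ × ℝ)) (b : Fin k → ℝ × ℝ × ℝ), (∀ (u : Fin n × Fin n → ℝ) (t : ℝ), (Real.log (MvPolynomial.eval (fun ij => Real.exp (u ij)) (Literature.Computability.AlgebraicComplexity.perPoly (Fin n) ℝ)) ≤ t ↔ ∃ y : Fin p → ℝ, ∀ i, (A ((u, t), y) + b) i ∈ {w : ℝ × ℝ × ℝ | (0 < w.2.1 ∧ w.2.1 * Real.exp (w.1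 / w.2.1) ≤ w.2.2) ∨ (w.2.1 = 0 ∧ w.1 ≤ 0 ∧ 0 ≤ w.2.2)})) → 2 ^ ((Nat.log 2 n + c) ^ c) < k

/-- item stmt-ValiantsHypothesis-0317 · support · rank 9 · closed · proved by Summit.ValiantsHypothesis.ValiantsHypothesis.Theorems.hubPerNotVp_proof @ 8fd72a57f796 (prover) · by planner
sources: Valiant1979, Burgisser2000
Hub lemma shared by all permanent-based routes: if the permanent family over ℂ is not a VP family
then VP ℂ ≠ VNP ℂ, given the renaming bridge (mem_VP_ofFintype_iff instance) and per ∈ VNP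
[Valiant1979; Burgisser2000 Thm 2.10]. Trivial bookkeeping; land once in
Summits/ValiantsHypothesis/Theorems/Hub/. -/
@[route_item "route-ValiantsHypothesis-FreeEnergyLift"]
def Hub : Prop :=
  ¬ Literature.Computability.AlgebraicComplexity.IsVPFamily (fun n => Literature.Computability.AlgebraicComplexity.perPoly (Fin n) ℂ) → (Literature.Computability.AlgebraicComplexity.perFamily ℂ ∈ Literature.Computability.AlgebraicComplexity.VP ℂ ↔ Literature.Computability.AlgebraicComplexity.IsVPFamily (fun n => Literature.Computability.AlgebraicComplexity.perPoly (Fin n) ℂ)) → Literature.Computability.AlgebraicComplexity.perFamily_mem_VNP ℂ → ValiantsHypothesis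

/-- `Hub` holds: proved by `Summit.ValiantsHypothesis.ValiantsHypothesis.Theorems.hubPerNotVp_proof` @ 8fd72a57f796. -/
theorem Hub_holds : Hub := _root_.Summit.ValiantsHypothesis.ValiantsHypothesis.Theorems.hubPerNotVp_proof

/-- item stmt-ValiantsHypothesis-5606 · support · rank 9 · closed · proved by Summit.ValiantsHypothesis.ValiantsHypothesis.Theorems.FreeEnergyLift.MonotoneLift.monotoneToLift_proof (prover) · by planner
sources: doi:10.4230/LIPIcs.CCC.2021.9, arXiv:1409.7640, JerrumSnir1982
[support] the dictionary (geometric programming, folklore): a Jerrum–Snir monotone computation P of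
f over ℝ≥0 (fan-in two, plain gates) yields an exact lift of {(u,t) : log f(e^u) ≤ t} by at most
8·size(P) + 8 exponential cones and no psd block (×-gate: add the log-variables; +-gate: t_v ≥
log(e^{t_a} + e^{t_b}) = two exp cones + one face inequality; gates computing 0 are pruned first).
[difficulty: provable-now] -/
@[route_item "route-ValiantsHypothesis-FreeEnergyLift"]
def MonotoneToLift : Prop :=
  ∀ (σ : Type) [Fintype σ] (P : Literature.Computability.AlgebraicComplexity.ArithCircuit NNReal σ) (f : MvPolynomial σ NNReal), Literature.Barriers.ValiantsHypothesis.IsMonotoneComputation P f → ∃ (k p : ℕ) (A : ((σ → ℝ) × ℝ) × (Fin p → ℝ) →ₗ[ℝ] (Fin k → ℝ × ℝ × ℝ)) (b : Fin k → ℝ × ℝ × ℝ), k ≤ 8 * P.size + 8 ∧ ∀ (u : σ → ℝ) (t : ℝ), (Real.log (MvPolynomial.eval (fun i => Real.exp (u i)) (MvPolynomial.map NNReal.toRealHom f)) ≤ t ↔ ∃ y : Fin p → ℝ, ∀ i, (A ((u, t), y) + b) i ∈ {w : ℝ × ℝ × ℝ | (0 < w.2.1 ∧ w.2.1 * Real.exp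 (w.1 / w.2.1) ≤ w.2.2) ∨ (w.2.1 = 0 ∧ w.1 ≤ 0 ∧ 0 ≤ w.2.2)})

-- `MonotoneToLift` holds: proved by `Summit.ValiantsHypothesis.ValiantsHypothesis.Theorems.FreeEnergyLift.MonotoneLift.monotoneToLift_proof` (its module imports this route file, so no `_holds` link can be stated here).

/-- item stmt-ValiantsHypothesis-5607 · support · rank 9 · closed · proved by Summit.ValiantsHypothesis.ValiantsHypothesis.Theorems.FreeEnergyLift.transferGivesSpanningTreeLift_proof (prover) · by planner
sources: JerrumSnir1982, arXiv:2109.06941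
[support] glue of the kill chain: H1 together with the cone fact `ST ∈ VP over every field` gives
the spanning-tree lift (instantiate H1 at σ N = Fin N × Option (Fin N), f N = stPoly ℝ≥0 N;
`map_stPoly` moves between ℝ≥0, ℝ, ℂ). Hence ¬SpanningTreeFreeEnergyLift ∧ isVPFamily_stPoly refutes
H1. [difficulty: provable-now] -/
@[route_item "route-ValiantsHypothesis-FreeEnergyLift"]
def TransferGivesSpanningTreeLift : Prop :=
  FreeEnergyLiftTransfer → Literature.Barriers.ValiantsHypothesis.isVPFamily_stPoly → SpanningTreeFreeEnergyLift

-- `TransferGivesSpanningTreeLift` holds: proved by `Summit.ValiantsHypothesis.ValiantsHypothesis.Theorems.FreeEnergyLift.transferGivesSpanningTreeLift_proof` (its module imports this route file, so no `_holds` link can be stated here).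

/-- item stmt-ValiantsHypothesis-5608 · assembly · rank 1 · closed · proved by Summit.ValiantsHypothesis.ValiantsHypothesis.Theorems.FreeEnergyLift.assembly_proof (prover) · by planner
sources: Valiant1979, Burgisser2000, arXiv:1111.3164
[assembly] FreeEnergyLiftTransfer → PermanentFreeEnergyNoQPLift → ValiantsHypothesis (hub facts are
proved theorems, used inside the proof). -/
@[route_item "route-ValiantsHypothesis-FreeEnergyLift"]
def Assembly : Prop :=
  FreeEnergyLiftTransfer → PermanentFreeEnergyNoQPLift → ValiantsHypothesis

-- `Assembly` holds: proved by `Summit.ValiantsHypothesis.ValiantsHypothesis.Theorems.FreeEnergyLift.assembly_proof` (its module imports this route file, so no `_holds` link can be stated here).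

end Summit.ValiantsHypothesis.ValiantsHypothesis.Theses.FreeEnergyLift
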